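import Mathlib
import Literature.NumberTheory.Transcendental.PeriodsWave0
import HarnessLib

/-!
# Fischler–Zudilin 2010: `dim_ℚ Span_ℚ(1, ζ(3), ζ(5), …, ζ(139)) ≥ 3` (named facts, statements only)

Topic `Literature/NumberTheory/Irrationality/FischlerZudilin2010` (staged by the pub cell `pub-zeta5`,
lane fam-indep; HONEST FRAMING: systematic search; no irrationality claim unless certified — this file
TYPES two printed, refereed statements as hypotheses `(h : …)`; nothing is proved or asserted here).

S. Fischler, W. Zudilin, *A refinement of Nesterenko's linear independence criterion with applications to
zeta values*, Math. Ann. **347** (2010) 739–763 [FischlerZudilin2010]: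

* p. 742, **Theorem 3.** "There exist odd integers `i₁ ≤ 139` and `i₂ ≤ 1961` such that the numbers
  `1, ζ(3), ζ(i₁), ζ(i₂)` are linearly independent over `ℚ`." — `theorem3`.
* p. 751, proof of Theorem 3 (§3.1, the choice `s = 70`, `t = 10` in Corollary 1 of the refined
  criterion Theorem 2 = tree `theorem2_holds`, with `1 − (log α − 3)/log β = 2.0004232415… > 2`):
  "hence `dim_ℚ Span_ℚ(1, ζ(3), ζ(5), …, ζ(139)) ≥ 3`" — `oddZetaDim139`, the record in print for
  `κ₃ := min {a odd : dim_ℚ Span_ℚ(1, ζ(3), …, ζ(a)) ≥ 3}` (`κ₃ ≤ 139`). The arithmetic inputs are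
  Zudilin's [Zudilin2002 = ref. 20 there, Props 2.1, 3.1, 4.1, Lemma 4.5] and the Krattenthaler–Rivoal
  denominators theorem [ref. 11 there] (tree: `KrattenthalerRivoal2007.theoreme1`).

Rendering: the span exactly in the shape of the tree's `Literature.NumberTheory.Transcendental.ball_rivoal`
(`insert 1 {ζ(k) : k odd, 3 ≤ k ≤ a}` with `zetaValue`), so that the cell's ladder
`Summit.KontsevichZagierPeriods.Zeta5Search.oddZetaSpanRank 69` rewrites to it
(`oddZetaSpanRank_eq_finrank_span_insert`).
-/

noncomputable section

namespace Literature.NumberTheory.Irrationality.FischlerZudilin2010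

open Literature.NumberTheory.Transcendental

/-- **Fischler–Zudilin 2010, §3.1 (proof of Theorem 3, `s = 70, t = 10`)** (named fact, statement only):
`dim_ℚ Span_ℚ(1, ζ(3), ζ(5), …, ζ(139)) ≥ 3`.
[cite: FischlerZudilin2010, §3.1 p. 751, proof of Theorem 3 (display after (10))] -/
def oddZetaDim139 : Prop :=
  3 ≤ Module.finrank ℚ (Submodule.span ℚ
    (insert (1 : ℝ) {x | ∃ k : ℕ, Odd k ∧ 3 ≤ k ∧ k ≤ 139 ∧ x = zetaValue k}))

/-- **Fischler–Zudilin 2010, Theorem 3** (named fact, statement only): there exist odd integers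
`i₁ ≤ 139` and `i₂ ≤ 1961` such that `1, ζ(3), ζ(i₁), ζ(i₂)` are linearly independent over `ℚ`.
[cite: FischlerZudilin2010, Theorem 3 (p. 742)] -/
def theorem3 : Prop :=
  ∃ i₁ i₂ : ℕ, Odd i₁ ∧ Odd i₂ ∧ i₁ ≤ 139 ∧ i₂ ≤ 1961 ∧
    LinearIndependent ℚ ![(1 : ℝ), zetaValue 3, zetaValue i₁, zetaValue i₂]

end Literature.NumberTheory.Irrationality.FischlerZudilin2010
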